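import Summits.HodgeConjecture.CorCM.Census.DecicWeil23PairDihedral
import HarnessLib

/-!
# ONE `(2,3)`-type over ANY DECIC CM field: the DEFECT LAW from the five powers of a realised `5`-CYCLE of the conjugate pairs
# (kernel census in the two-type model of `Census/DecicWeil23Pair`, second type slot empty)

COR-CM (cell `pub-hodgecm2`), seat b30 gen 23 (2026-08-22); count-neutral own lane DECIC-2T, part 3 («DECIC-D5»/«DECIC-C5-ANY»).
Bookkeeping definition (`cyclicPerms j`, the five rotations of the dihedral table `dihTab j` of `Census/DecicWeil23PairDihedral`,
i.e. the six Sylow `5`-subgroups `P_j` of `Sym(5)`) and theorems; no named fact, no geometry, no `sorry`.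

WHY.  Every transitive subgroup of `Sym(5)` contains a `5`-cycle (Cauchy), i.e. one of the six groups `P_j`; and for ONE
`(2,3)`-type (normalised to the pairs `I_0 = {0, 1}`) the five signed equations of ANY `P_j` already have nullity `1` (exact
census `work/d5`: all six `j`), i.e. force the defect law `d_{0,a} = d_{0,0}`, `e = d_{0,0}` on configurations without points on
the second fivefold slot (`d_{1,a} = 0`).  Hence: a configuration of a product of copies of `E` and ONE fivefold `B`, balanced
under the five powers of a realised `5`-cycle, satisfies all sixty `A₅` equations `ModelBalancedD`
(**`modelBalancedD_of_modelBalancedP_cyclic`**), and the whole `DecicWeil23Pair` chain applies BY NAME — for EVERY decic CM field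
`K ⊇ i(k)` (no condition on the quintic part beyond a realised `5`-cycle), superseding for one type both the `2`-transitive
theorem of this gen and seat b09's cyclic-Galois `DecicCurveFivefold*`.
[cite: DixonMortimer1996, §2.1] [cite: MoonenZarhin1995Duke, Thm. 2.4] [cite: GaoUllmo2025, Thm 3.1] [cite: Pohlmann1968, Thm 1]

## References
* [DixonMortimer1996] J. D. Dixon, B. Mortimer, *Permutation Groups*, GTM 163 (1996), §2.1 (a transitive group of prime degree `p`
  has order divisible by `p`, hence contains a `p`-cycle by Cauchy's theorem).  [MoonenZarhin1995Duke] B. Moonen, Yu. Zarhin, Duke Math. J. 77 (1995), Thm. 2.4.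
  [GaoUllmo2025] Z. Gao, E. Ullmo, J. Inst. Math. Jussieu 25 (2025), Thm 3.1.  [Pohlmann1968] H. Pohlmann, Ann. of Math. 88 (1968), Thm 1.
-/

namespace Summit.HodgeConjecture.CorCM.Census.DecicWeil23Pair

open Finset

/-! ## §1 The six cyclic groups `P_j` -/

/-- **The Sylow `5`-subgroup `P_j ⊂ D₅(j)`**: the five rotations, rows `0–4` of `dihTab j`. [folklore] -/
noncomputable def cyclicPerms (j : Fin 6) : Finset (Equiv.Perm (Fin 5)) :=
  ((univ : Finset (Fin 10)).filter fun t : Fin 10 => (t : ℕ) < 5).image (dihPerm j)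

/-- The rotation rows are members of `cyclicPerms j`. [folklore] -/
theorem dihPerm_mem_cyclicPerms (j : Fin 6) {t : Fin 10} (ht : (t : ℕ) < 5) : dihPerm j t ∈ cyclicPerms j :=
  Finset.mem_image.2 ⟨t, Finset.mem_filter.2 ⟨Finset.mem_univ _, ht⟩, rfl⟩

/-- Membership in `cyclicPerms j`. [folklore] -/
theorem mem_cyclicPerms {j : Fin 6} {π : Equiv.Perm (Fin 5)} :
    π ∈ cyclicPerms j ↔ ∃ t : Fin 10, (t : ℕ) < 5 ∧ dihPerm j t = π := by
  constructor
  · intro h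
    obtain ⟨t, ht, rfl⟩ := Finset.mem_image.1 h
    exact ⟨t, (Finset.mem_filter.1 ht).2, rfl⟩
  · rintro ⟨t, ht, rfl⟩
    exact dihPerm_mem_cyclicPerms j ht

/-- `cyclicPerms j ⊆ dihedralPerms j`. [folklore] -/
theorem cyclicPerms_subset_dihedralPerms (j : Fin 6) : cyclicPerms j ⊆ dihedralPerms j := by
  intro π hπ
  obtain ⟨t, -, rfl⟩ := mem_cyclicPerms.1 hπ
  exact dihPerm_mem j t

/-- **The rotations are the powers of any nontrivial rotation power** `ρ_j^{a+1}` (`a < 4`). [folklore] -/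
theorem dihPerm_rot_eq_pow : ∀ (j : Fin 6) (a : Fin 4) (t : Fin 10), (t : ℕ) < 5 →
    ∃ i : Fin 5, dihPerm j t = (dihPerm j 1 ^ ((a : ℕ) + 1)) ^ (i : ℕ) := by
  decide +kernel

/-! ## §2 The one-type defect law under `P_j` -/

/-- The one-type defect law from the five rotations of `dihTab 0` (linear algebra). [folklore] -/
private theorem defect_cyc_0 (c : Bool) (e : ℤ) (d : Fin 2 → Fin 5 → ℤ) (hd1 : ∀ a : Fin 5, d 1 a = 0)
    (h : ∀ t : Fin 10, (t : ℕ) < 5 →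
      e + ∑ m : Fin 2, ∑ a : Fin 5, (if inPos c m (dihTab 0 t a) then d m a else -d m a) = 0) :
    (∀ (m : Fin 2) (a : Fin 5), d m a = d m 0) ∧ e = d 0 0 + d 1 0 := by
  have h0 := h 0 (by decide); have h1 := h 1 (by decide); have h2 := h 2 (by decide); have h3 := h 3 (by decide)
  have h4 := h 4 (by decide)
  simp [Fin.sum_univ_two, Fin.sum_univ_five, inPos, dihTab, hd1] at h0 h1 h2 h3 h4
  have e01 : d 0 1 = d 0 0 := by linarith
  have e02 : d 0 2 = d 0 0 := by linarith
  have e03 : d 0 3 = d 0 0 := by linarith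
  have e04 : d 0 4 = d 0 0 := by linarith
  refine ⟨fun m a => ?_, by rw [hd1]; linarith⟩
  fin_cases m <;> fin_cases a
  exacts [rfl, e01, e02, e03, e04, rfl, (hd1 1).trans (hd1 0).symm, (hd1 2).trans (hd1 0).symm,
    (hd1 3).trans (hd1 0).symm, (hd1 4).trans (hd1 0).symm]

/-- The one-type defect law from the five rotations of `dihTab 1` (linear algebra). [folklore] -/
private theorem defect_cyc_1 (c : Bool) (e : ℤ) (d : Fin 2 → Fin 5 → ℤ) (hd1 : ∀ a : Fin 5, d 1 a = 0)
    (h : ∀ t : Fin 10, (t : ℕ) < 5 →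
      e + ∑ m : Fin 2, ∑ a : Fin 5, (if inPos c m (dihTab 1 t a) then d m a else -d m a) = 0) :
    (∀ (m : Fin 2) (a : Fin 5), d m a = d m 0) ∧ e = d 0 0 + d 1 0 := by
  have h0 := h 0 (by decide); have h1 := h 1 (by decide); have h2 := h 2 (by decide); have h3 := h 3 (by decide)
  have h4 := h 4 (by decide)
  simp [Fin.sum_univ_two, Fin.sum_univ_five, inPos, dihTab, hd1] at h0 h1 h2 h3 h4
  have e01 : d 0 1 = d 0 0 := by linarith
  have e02 : d 0 2 = d 0 0 := by linarith
  have e03 : d 0 3 = d 0 0 := by linarith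
  have e04 : d 0 4 = d 0 0 := by linarith
  refine ⟨fun m a => ?_, by rw [hd1]; linarith⟩
  fin_cases m <;> fin_cases a
  exacts [rfl, e01, e02, e03, e04, rfl, (hd1 1).trans (hd1 0).symm, (hd1 2).trans (hd1 0).symm,
    (hd1 3).trans (hd1 0).symm, (hd1 4).trans (hd1 0).symm]

/-- The one-type defect law from the five rotations of `dihTab 2` (linear algebra). [folklore] -/
private theorem defect_cyc_2 (c : Bool) (e : ℤ) (d : Fin 2 → Fin 5 → ℤ) (hd1 : ∀ a : Fin 5, d 1 a = 0)
    (h : ∀ t : Fin 10, (t : ℕ) < 5 →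
      e + ∑ m : Fin 2, ∑ a : Fin 5, (if inPos c m (dihTab 2 t a) then d m a else -d m a) = 0) :
    (∀ (m : Fin 2) (a : Fin 5), d m a = d m 0) ∧ e = d 0 0 + d 1 0 := by
  have h0 := h 0 (by decide); have h1 := h 1 (by decide); have h2 := h 2 (by decide); have h3 := h 3 (by decide)
  have h4 := h 4 (by decide)
  simp [Fin.sum_univ_two, Fin.sum_univ_five, inPos, dihTab, hd1] at h0 h1 h2 h3 h4
  have e01 : d 0 1 = d 0 0 := by linarith
  have e02 : d 0 2 = d 0 0 := by linarith
  have e03 : d 0 3 = d 0 0 := by linarith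
  have e04 : d 0 4 = d 0 0 := by linarith
  refine ⟨fun m a => ?_, by rw [hd1]; linarith⟩
  fin_cases m <;> fin_cases a
  exacts [rfl, e01, e02, e03, e04, rfl, (hd1 1).trans (hd1 0).symm, (hd1 2).trans (hd1 0).symm,
    (hd1 3).trans (hd1 0).symm, (hd1 4).trans (hd1 0).symm]

/-- The one-type defect law from the five rotations of `dihTab 3` (linear algebra). [folklore] -/
private theorem defect_cyc_3 (c : Bool) (e : ℤ) (d : Fin 2 → Fin 5 → ℤ) (hd1 : ∀ a : Fin 5, d 1 a = 0)
    (h : ∀ t : Fin 10, (t : ℕ) < 5 →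
      e + ∑ m : Fin 2, ∑ a : Fin 5, (if inPos c m (dihTab 3 t a) then d m a else -d m a) = 0) :
    (∀ (m : Fin 2) (a : Fin 5), d m a = d m 0) ∧ e = d 0 0 + d 1 0 := by
  have h0 := h 0 (by decide); have h1 := h 1 (by decide); have h2 := h 2 (by decide); have h3 := h 3 (by decide)
  have h4 := h 4 (by decide)
  simp [Fin.sum_univ_two, Fin.sum_univ_five, inPos, dihTab, hd1] at h0 h1 h2 h3 h4
  have e01 : d 0 1 = d 0 0 := by linarith
  have e02 : d 0 2 = d 0 0 := by linarith
  have e03 : d 0 3 = d 0 0 := by linarith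
  have e04 : d 0 4 = d 0 0 := by linarith
  refine ⟨fun m a => ?_, by rw [hd1]; linarith⟩
  fin_cases m <;> fin_cases a
  exacts [rfl, e01, e02, e03, e04, rfl, (hd1 1).trans (hd1 0).symm, (hd1 2).trans (hd1 0).symm,
    (hd1 3).trans (hd1 0).symm, (hd1 4).trans (hd1 0).symm]

/-- The one-type defect law from the five rotations of `dihTab 4` (linear algebra). [folklore] -/
private theorem defect_cyc_4 (c : Bool) (e : ℤ) (d : Fin 2 → Fin 5 → ℤ) (hd1 : ∀ a : Fin 5, d 1 a = 0)
    (h : ∀ t : Fin 10, (t : ℕ) < 5 →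
      e + ∑ m : Fin 2, ∑ a : Fin 5, (if inPos c m (dihTab 4 t a) then d m a else -d m a) = 0) :
    (∀ (m : Fin 2) (a : Fin 5), d m a = d m 0) ∧ e = d 0 0 + d 1 0 := by
  have h0 := h 0 (by decide); have h1 := h 1 (by decide); have h2 := h 2 (by decide); have h3 := h 3 (by decide)
  have h4 := h 4 (by decide)
  simp [Fin.sum_univ_two, Fin.sum_univ_five, inPos, dihTab, hd1] at h0 h1 h2 h3 h4
  have e01 : d 0 1 = d 0 0 := by linarith
  have e02 : d 0 2 = d 0 0 := by linarith
  have e03 : d 0 3 = d 0 0 := by linarith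
  have e04 : d 0 4 = d 0 0 := by linarith
  refine ⟨fun m a => ?_, by rw [hd1]; linarith⟩
  fin_cases m <;> fin_cases a
  exacts [rfl, e01, e02, e03, e04, rfl, (hd1 1).trans (hd1 0).symm, (hd1 2).trans (hd1 0).symm,
    (hd1 3).trans (hd1 0).symm, (hd1 4).trans (hd1 0).symm]

/-- The one-type defect law from the five rotations of `dihTab 5` (linear algebra). [folklore] -/
private theorem defect_cyc_5 (c : Bool) (e : ℤ) (d : Fin 2 → Fin 5 → ℤ) (hd1 : ∀ a : Fin 5, d 1 a = 0)
    (h : ∀ t : Fin 10, (t : ℕ) < 5 →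
      e + ∑ m : Fin 2, ∑ a : Fin 5, (if inPos c m (dihTab 5 t a) then d m a else -d m a) = 0) :
    (∀ (m : Fin 2) (a : Fin 5), d m a = d m 0) ∧ e = d 0 0 + d 1 0 := by
  have h0 := h 0 (by decide); have h1 := h 1 (by decide); have h2 := h 2 (by decide); have h3 := h 3 (by decide)
  have h4 := h 4 (by decide)
  simp [Fin.sum_univ_two, Fin.sum_univ_five, inPos, dihTab, hd1] at h0 h1 h2 h3 h4
  have e01 : d 0 1 = d 0 0 := by linarith
  have e02 : d 0 2 = d 0 0 := by linarith
  have e03 : d 0 3 = d 0 0 := by linarith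
  have e04 : d 0 4 = d 0 0 := by linarith
  refine ⟨fun m a => ?_, by rw [hd1]; linarith⟩
  fin_cases m <;> fin_cases a
  exacts [rfl, e01, e02, e03, e04, rfl, (hd1 1).trans (hd1 0).symm, (hd1 2).trans (hd1 0).symm,
    (hd1 3).trans (hd1 0).symm, (hd1 4).trans (hd1 0).symm]

/-- **THE ONE-TYPE DEFECT LAW UNDER A `5`-CYCLE.**  If the second fivefold slot carries nothing (`d_{1,a} = 0`), the signed
equations at the five rotations of `P_j` (any `j < 6`, any `c`) force `d_{0,a} = d_{0,0}` and `e = d_{0,0} (+ d_{1,0})`.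
[cite: MoonenZarhin1995Duke, Thm. 2.4] [cite: GaoUllmo2025, Thm 3.1] -/
theorem defectD_of_signed_cyclic (c : Bool) (j : Fin 6) (e : ℤ) (d : Fin 2 → Fin 5 → ℤ) (hd1 : ∀ a : Fin 5, d 1 a = 0)
    (h : ∀ t : Fin 10, (t : ℕ) < 5 →
      e + ∑ m : Fin 2, ∑ a : Fin 5, (if inPos c m (dihTab j t a) then d m a else -d m a) = 0) :
    (∀ (m : Fin 2) (a : Fin 5), d m a = d m 0) ∧ e = d 0 0 + d 1 0 := by
  fin_cases j
  exacts [defect_cyc_0 c e d hd1 h, defect_cyc_1 c e d hd1 h, defect_cyc_2 c e d hd1 h, defect_cyc_3 c e d hd1 h,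
    defect_cyc_4 c e d hd1 h, defect_cyc_5 c e d hd1 h]

/-! ## §3 `P_j`-balanced one-type configurations are `A₅`-balanced -/

variable {α : Type*} {c : Bool} {v : α → PtD}

/-- **`P_j`-BALANCED ⟹ `A₅`-BALANCED for configurations without points on the second fivefold slot**: balanced under the five
rotations of a Sylow `5`-subgroup (`ModelBalancedP c (cyclicPerms j) v T`) and `v x ≠ (1, a, b)` on `T` ⟹ all sixty equations
`ModelBalancedD` of `Census/DecicWeil23Pair`. [cite: MoonenZarhin1995Duke, Thm. 2.4] [cite: GaoUllmo2025, Thm 3.1] -/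
theorem modelBalancedD_of_modelBalancedP_cyclic (j : Fin 6) {T : Finset α}
    (hT1 : ∀ x ∈ T, ∀ (a : Fin 5) (b : Bool), v x ≠ Sum.inr (1, (a, b)))
    (hT : ModelBalancedP c (cyclicPerms j) v T) : ModelBalancedD c v T := by
  have hz : ∀ (a : Fin 5) (b : Bool), (T.filter fun x => v x = Sum.inr (1, (a, b))).card = 0 := fun a b =>
    Finset.card_eq_zero.2 (Finset.filter_eq_empty_iff.2 fun x hx h => hT1 x hx a b h)
  have hs : ∀ t : Fin 10, (t : ℕ) < 5 →
      (((T.filter fun x => v x = Sum.inl true).card : ℤ) - (T.filter fun x => v x = Sum.inl false).card) +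
      ∑ m : Fin 2, ∑ a : Fin 5, (if inPos c m (dihTab j t a) then
        (((T.filter fun x => v x = Sum.inr (m, (a, true))).card : ℤ) - (T.filter fun x => v x = Sum.inr (m, (a, false))).card)
        else -((((T.filter fun x => v x = Sum.inr (m, (a, true))).card : ℤ) -
          (T.filter fun x => v x = Sum.inr (m, (a, false))).card))) = 0 :=
    fun t ht => (balancedP_iff_signed c (dihPerm j t) (fun y => (T.filter fun x => v x = y).card)).1 (by
      have h := hT (dihPerm j t) (dihPerm_mem_cyclicPerms j ht)
      rw [card_filter_mem_eq_sumD, card_eq_sumD v T] at h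
      exact h)
  obtain ⟨hd, he⟩ := defectD_of_signed_cyclic c j _
    (fun m a => (((T.filter fun x => v x = Sum.inr (m, (a, true))).card : ℕ) : ℤ) -
      (T.filter fun x => v x = Sum.inr (m, (a, false))).card) (fun a => by
        show (((T.filter fun x => v x = Sum.inr (1, (a, true))).card : ℕ) : ℤ) -
          (T.filter fun x => v x = Sum.inr (1, (a, false))).card = 0
        rw [hz, hz]; simp) hs
  intro r
  rw [card_filter_mem_eq_sumD, card_eq_sumD v T, balancedD_iff_signed]
  exact signed_of_defectD c (Equiv.ofBijective (permD r) (Finite.injective_iff_bijective.1 (permD_facts.1 r))) hd he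

end Summit.HodgeConjecture.CorCM.Census.DecicWeil23Pair
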